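import Mathlib
import Literature.AlgebraicGeometry.Resolution.CobordantGame
import Summits.ResolutionOfSingularities.ResolutionOfSingularities.Theorems.WeightedInvariantLocalWeightedDropTwistedTrivialWitnesses

/-!
# `WeightedInvariant.LocalWeightedDrop`: twisted-triviality of two calibration specimens (§4 R2-3 `g₅`, §7 R3-HP2 `hpB`)

Route `ResolutionOfSingularities/WeightedInvariant`, crux `LocalWeightedDrop`
(stmt-ResolutionOfSingularities-8899).  [OURS · L1 W4.3] — two further sorried calibration statements of ideator
res-L1-w43-idea-1's `Sketch-L1-idea-1.lean` (v4), for the ORIGIN-FIXING predicate `GradedGame.TwistedTrivialAlongFix`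
(= the sketch's v4 `TwistedTrivialAlong`), both with an EXPLICIT unipotent `Φ` and `u = 1`
(`twistedTrivialAlongFix_of_unipotent`).  Nothing here is a statement of the manuscript under review on ladder
RESOLUTION; AI-produced, weaker than expert review.

* §4 R2-3 `g5_twistedTrivialFix_u` — the honest 5-variable wild successor `g₅ = X² + uZ⁴ + u³S⁴ + S t³` (char 2;
  `0 = X, 1 = u, 2 = Z, 3 = S, 4 = t`) is twisted-trivial of exponent `2¹` along the `u`-axis: the S1W automorphism
  `X ↦ X + σZ² + σ³S² + σuS², Z ↦ Z + σS` (the term `S t³` is untouched by both the translation and `Φ`).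
* §7 R3-HP2 `hpB_twistedTrivialFix_l` — HauserPerlega2019 Example 1, class `B`: `h = z⁸ + l⁴w⁸ + s·w⁶u¹⁰` (char 2;
  `0 = z, 1 = l, 2 = w, 3 = s, 4 = u`) is twisted-trivial of exponent `2¹` along `l`: `(l + σ²)⁴ = l⁴ + σ⁸` is absorbed by
  `z ↦ z + σw` (`(z + σw)⁸ = z⁸ + σ⁸w⁸`).
The characteristic-2 identities are closed by `linear_combination c * (2 = 0)` with explicit cofactors `c`.
-/

set_option linter.dupNamespace false -- mandated namespace of this single-conjunct summit
set_option autoImplicit false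

namespace Summit.ResolutionOfSingularities.ResolutionOfSingularities.Theorems

namespace GradedGame

open MvPowerSeries
open Literature.AlgebraicGeometry.Resolution

variable {k : Type} [Field k]

/-- §4 R2-3 — the honest 5-variable wild successor `g₅ = X² + uZ⁴ + u³S⁴ + S t³` (char 2; `0 = X, 1 = u, 2 = Z, 3 = S,
4 = t`) is twisted-trivial of exponent `2¹` along the `u`-axis in the origin-fixing sense, by the S1W automorphism
`Φ : X ↦ X + σZ² + σ³S² + σuS², Z ↦ Z + σS, u, S, t ↦ u, S, t`, `u = 1`. [OURS · L1 W4.3, Sketch-L1-idea-1 v4 §4 R2-3 for the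
repaired predicate; the sketch's `[IsAlgClosed k]` is not needed] -/
theorem g5_twistedTrivialFix_u [CharP k 2] :
    TwistedTrivialAlongFix 2 (X 0 ^ 2 + X 1 * X 2 ^ 4 + X 1 ^ 3 * X 3 ^ 4 + X 3 * X 4 ^ 3 : MvPowerSeries (Fin 5) k)
      (axisCurve 1) := by
  classical
  haveI : CharP (MvPowerSeries (Fin (5 + 1)) k) 2 := charP_of_injective_ringHom C_injective 2
  have h2 : (2 : MvPowerSeries (Fin (5 + 1)) k) = 0 := CharP.ofNat_eq_zero _ 2
  -- shifted variables: `σ = X 0`, `X = x0`, `u = x1`, `Z = x2`, `S = x3`, `t = x4`, `xj = X (Fin.succ j)`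
  set extra : Fin 5 → MvPowerSeries (Fin (5 + 1)) k := fun j =>
    if j = 0 then X 0 * X (Fin.succ (2 : Fin 5)) ^ 2 + X 0 ^ 3 * X (Fin.succ (3 : Fin 5)) ^ 2
      + (X 0 * X (Fin.succ (1 : Fin 5))) * X (Fin.succ (3 : Fin 5)) ^ 2
    else if j = 2 then X 0 * X (Fin.succ (3 : Fin 5)) else 0 with hextra
  have hK := hasSubst_keep (k := k) (fun v : Fin (5 + 1) => v = 0)
  refine twistedTrivialAlongFix_of_unipotent 2 1 (by norm_num) _ 1 extra (fun j => ?_) (fun j l => ?_) (fun j => ?_) ?_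
  · simp only [hextra]; split_ifs <;> simp [constantCoeff_X]
  · simp only [hextra]
    split_ifs
    · rw [map_add, map_add, coeff_single_one_mul_eq_zero _ _ (by simp [constantCoeff_X]) (by simp [constantCoeff_X]),
        coeff_single_one_mul_eq_zero _ _ (by simp [constantCoeff_X]) (by simp [constantCoeff_X]),
        coeff_single_one_mul_eq_zero _ _ (by simp [constantCoeff_X]) (by simp [constantCoeff_X]), add_zero, add_zero]
    · exact coeff_single_one_mul_eq_zero _ _ (by simp [constantCoeff_X]) (by simp [constantCoeff_X]) _
    · simp
  · have hKeq : (fun v : Fin (5 + 1) => if v = 0 then (X (0 : Fin (5 + 1)) : MvPowerSeries (Fin (5 + 1)) k) else 0) =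
        fun v : Fin (5 + 1) => if v = 0 then (X v : MvPowerSeries (Fin (5 + 1)) k) else 0 := by
      funext v; by_cases hv : v = 0 <;> simp [hv]
    rw [hKeq]
    simp only [hextra]
    split_ifs
    · simp only [subst_add hK, subst_mul hK, subst_pow hK, subst_X hK]
      simp
    · rw [subst_mul hK, subst_X hK, subst_X hK]
      simp
    · rw [← coe_substAlgHom hK, map_zero]
  · have hT : HasSubst (fun j : Fin 5 => X j.succ +
        if j = 1 then (X (0 : Fin (5 + 1)) : MvPowerSeries (Fin (5 + 1)) k) ^ (2 ^ 1) else 0) :=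
      hasSubst_of_constantCoeff_zero fun j => by by_cases hj : j = 1 <;> simp [hj, constantCoeff_X]
    have hP : HasSubst (fun j : Fin 5 => X j.succ + extra j) :=
      hasSubst_of_constantCoeff_zero fun j => by
        simp only [hextra]; by_cases hj : j = 0 <;> by_cases hj' : j = 2 <;> simp [hj, hj', constantCoeff_X]
    simp only [← coe_substAlgHom hT, ← coe_substAlgHom hP, map_add, map_mul, map_pow, substAlgHom_X]
    simp only [hextra, Fin.isValue, Fin.reduceEq, ↓reduceIte, add_zero]
    set x0 : MvPowerSeries (Fin (5 + 1)) k := X (Fin.succ (0 : Fin 5))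
    set x1 : MvPowerSeries (Fin (5 + 1)) k := X (Fin.succ (1 : Fin 5))
    set x2 : MvPowerSeries (Fin (5 + 1)) k := X (Fin.succ (2 : Fin 5))
    set x3 : MvPowerSeries (Fin (5 + 1)) k := X (Fin.succ (3 : Fin 5))
    linear_combination (- 2 * X 0 * x1 * x2 ^ 3 * x3 - X 0 * x0 * x2 ^ 2 - X 0 * x0 * x1 * x3 ^ 2
      - 4 * X 0 ^ 2 * x1 * x2 ^ 2 * x3 ^ 2 + X 0 ^ 2 * x1 ^ 2 * x3 ^ 4 - 2 * X 0 ^ 3 * x1 * x2 * x3 ^ 3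
      - X 0 ^ 3 * x0 * x3 ^ 2 - X 0 ^ 4 * x2 ^ 2 * x3 ^ 2 : MvPowerSeries (Fin (5 + 1)) k) * h2

/-- §7 R3-HP2 — HauserPerlega2019 Example 1, class `B`: `h = z⁸ + l⁴w⁸ + s·w⁶u¹⁰` (char 2; `0 = z, 1 = l, 2 = w, 3 = s, 4 = u`)
is twisted-trivial of exponent `2¹` along the `l`-axis in the origin-fixing sense: translating `l ↦ l + σ²` is undone by
`Φ : z ↦ z + σw` (unipotent, origin-fixing), `u = 1`. [OURS · L1 W4.3, Sketch-L1-idea-1 v4 §7 R3-HP2 for the repaired predicate;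
the sketch's `[IsAlgClosed k]` is not needed] -/
theorem hpB_twistedTrivialFix_l [CharP k 2] :
    TwistedTrivialAlongFix 2 (X 0 ^ 8 + X 1 ^ 4 * X 2 ^ 8 + X 3 * X 2 ^ 6 * X 4 ^ 10 : MvPowerSeries (Fin 5) k)
      (axisCurve 1) := by
  classical
  haveI : CharP (MvPowerSeries (Fin (5 + 1)) k) 2 := charP_of_injective_ringHom C_injective 2
  have h2 : (2 : MvPowerSeries (Fin (5 + 1)) k) = 0 := CharP.ofNat_eq_zero _ 2
  -- shifted variables: `σ = X 0`, `z = x0`, `l = x1`, `w = x2`, `s = x3`, `u = x4`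
  set extra : Fin 5 → MvPowerSeries (Fin (5 + 1)) k := fun j =>
    if j = 0 then X 0 * X (Fin.succ (2 : Fin 5)) else 0 with hextra
  have hK := hasSubst_keep (k := k) (fun v : Fin (5 + 1) => v = 0)
  refine twistedTrivialAlongFix_of_unipotent 2 1 (by norm_num) _ 1 extra (fun j => ?_) (fun j l => ?_) (fun j => ?_) ?_
  · simp only [hextra]; split_ifs <;> simp [constantCoeff_X]
  · simp only [hextra]
    split_ifs
    · exact coeff_single_one_mul_eq_zero _ _ (by simp [constantCoeff_X]) (by simp [constantCoeff_X]) _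
    · simp
  · have hKeq : (fun v : Fin (5 + 1) => if v = 0 then (X (0 : Fin (5 + 1)) : MvPowerSeries (Fin (5 + 1)) k) else 0) =
        fun v : Fin (5 + 1) => if v = 0 then (X v : MvPowerSeries (Fin (5 + 1)) k) else 0 := by
      funext v; by_cases hv : v = 0 <;> simp [hv]
    rw [hKeq]
    simp only [hextra]
    split_ifs
    · rw [subst_mul hK, subst_X hK, subst_X hK]
      simp
    · rw [← coe_substAlgHom hK, map_zero]
  · have hT : HasSubst (fun j : Fin 5 => X j.succ +
        if j = 1 then (X (0 : Fin (5 + 1)) : MvPowerSeries (Fin (5 + 1)) k) ^ (2 ^ 1) else 0) :=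
      hasSubst_of_constantCoeff_zero fun j => by by_cases hj : j = 1 <;> simp [hj, constantCoeff_X]
    have hP : HasSubst (fun j : Fin 5 => X j.succ + extra j) :=
      hasSubst_of_constantCoeff_zero fun j => by
        simp only [hextra]; by_cases hj : j = 0 <;> simp [hj, constantCoeff_X]
    simp only [← coe_substAlgHom hT, ← coe_substAlgHom hP, map_add, map_mul, map_pow, substAlgHom_X]
    simp only [hextra, Fin.isValue, Fin.reduceEq, ↓reduceIte, add_zero]
    set x0 : MvPowerSeries (Fin (5 + 1)) k := X (Fin.succ (0 : Fin 5))
    set x1 : MvPowerSeries (Fin (5 + 1)) k := X (Fin.succ (1 : Fin 5))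
    set x2 : MvPowerSeries (Fin (5 + 1)) k := X (Fin.succ (2 : Fin 5))
    linear_combination (- 4 * X 0 * x0 ^ 7 * x2 + 2 * X 0 ^ 2 * x1 ^ 3 * x2 ^ 8 - 14 * X 0 ^ 2 * x0 ^ 6 * x2 ^ 2
      - 28 * X 0 ^ 3 * x0 ^ 5 * x2 ^ 3 + 3 * X 0 ^ 4 * x1 ^ 2 * x2 ^ 8 - 35 * X 0 ^ 4 * x0 ^ 4 * x2 ^ 4
      - 28 * X 0 ^ 5 * x0 ^ 3 * x2 ^ 5 + 2 * X 0 ^ 6 * x1 * x2 ^ 8 - 14 * X 0 ^ 6 * x0 ^ 2 * x2 ^ 6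
      - 4 * X 0 ^ 7 * x0 * x2 ^ 7 : MvPowerSeries (Fin (5 + 1)) k) * h2

end GradedGame

end Summit.ResolutionOfSingularities.ResolutionOfSingularities.Theorems
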